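import Literature.NumberTheory.ModularSymbols.CuspidalHomologyHeckeModule
import Mathlib.Algebra.CharP.Basic
import HarnessLib

/-!
# The norm `Nm = 1 + t + t²` of the shift, the Prym lattice `Λ_P = ker Nm` and the fixed lattice
# `Λ_B = ker(t − 1)` in `H₁(X₀(N), ℤ)` (`9 ∣ N`), their mod-`n` fibres in `J₀(N)(ℂ)`, and Hecke-isotypic
# pieces (sequel to `CuspidalHomologyHeckeModule`; definition request of the cell `bsd-idea-3`,
# post32/post33 of 2026-08-28, items (1)–(3))

Topic `Literature/NumberTheory/ModularSymbols`. Everything here is elementary algebra over the tree's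
carrier — the integral period homology `Λ = periodHomologyHecke N = H₁(X₀(N), ℤ) ⊆ V = S₂(Γ₀(N))^∨`
(`ModularSymbolsPeriodHomology`, `ModularJacobianModPMultiplicityOne`), the analytic Jacobian
`J0 N = V/Λ` with its shift `J0.shift` (`AlgebraicModularParametrizationWithShift`), and the shift
`t_* = shiftDual N h9` / `shiftInt N h9` / `shift N h9 R` of `CuspidalHomologyHeckeModule` — for the
cyclic triple cover `π : X₀(N) → X₀(N)/⟨t⟩ ≅ X₀(N/3)`, `t : τ ↦ τ + 1/3` (`9 ∣ N`; Harrison 2011 §2: the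
automorphism `S₃` of order `3`). For such a cover `π^* π_* = 1 + t_* + t_*² =: Nm` on `H₁` and on the
Jacobian, so the `π^*J₀(N/3)`-part and the Prym part are visible on `X₀(N)` alone, WITHOUT degeneracy maps:

* `normDual N h9 = 1 + t_* + t_*²` on `V`, `normInt N h9` on `Λ`, `norm N h9 R = 1 + t + t²` on
  `H(N; R) = R ⊗ Λ`, `jacobianNorm N h9` on `J0 N`; the ring identities that drive everything (all from
  `t³ = 1`): `t·Nm = Nm = Nm·t`, `(t − 1)·Nm = 0 = Nm·(t − 1)`, `3 = Nm + (1 − t)(2 + t)`,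
  `(1 − t)² = Nm − 3t`;
* the **fixed lattice** `fixedLattice N h9 = Λ_B := ker(t_* − 1) ⊆ Λ` ("`= Λ ∩ π^*H₁(X₀(N/3))`") and the
  **Prym lattice** `prymLattice N h9 = Λ_P := ker Nm ⊆ Λ`: both saturated, `Λ_B ∩ Λ_P = 0`,
  `3Λ ⊆ Λ_B ⊕ Λ_P`, `Nm Λ ⊆ Λ_B`, `(1 − t)Λ ⊆ Λ_P`, both `t`-stable and `T_p`-stable for every prime
  `p ≠ 3` (`Nm` commutes with `T_p`, `p ≠ 3`, by `T_p t = t^{±1} T_p`); on `Λ_P`: `(1 − t)² = −3t`,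
  `1 − t` is injective, `3Λ_P ⊆ (1 − t)Λ_P`, and the **mod-`3` exactness**
  `{x ∈ Λ_P : (1 − t)x ∈ 3Λ_P} = (1 − t)Λ_P` (i.e. `ker(1 − t̄) = im(1 − t̄)` on `Λ_P/3Λ_P`);
* the same over `R`: `prym N h9 R = ker(norm) ⊆ H(N; R)`, `fixedPart N h9 R = ker(t − 1)`; when `3 = 0`
  in `R` (`CharP R 3`): `Nm = (1 − t)²`, so `fixedPart ≤ prym` and `(1 − t)² = 0` on `prym`;
* on the Jacobian: `jacobianNorm`, `B := normRange = Nm(J₀(N)(ℂ))` (pointwise `t`-fixed) and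
  `P := prymTorus` (the image of `ker(Nm | V)`); the **mod-`n` fibre map**
  `prymDivMap N h9 n : Λ_P → J₀(N)(ℂ)`, `x ↦ [n⁻¹x]`, with values in `P ∩ J₀(N)[n]`, kernel `nΛ_P` and
  image all of `P[n]` (`Λ_P/nΛ_P ≅ P[n]`), `t`- and `𝕋`-equivariant, and the transport of the
  `t`-fixed part: `[n⁻¹x]` is `t`-fixed iff `(t − 1)x ∈ nΛ_P` — so for `n = 3` the `t`-fixed Prym
  `3`-torsion `Φ` corresponds to `ker(1 − t̄) = im(1 − t̄) ⊆ Λ_P/3Λ_P`;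
* **the lattice `Λ₁ := (t − 1)Λ = range(t_* − 1)`** (`shiftSubOneLattice`; the cell's post35:
  `Λ₁ ⊗ ℝ/Λ₁ ≅ J₀(N)/B`): `3Λ_P ⊆ Λ₁ ⊆ Λ_P`, generated by the symbol differences
  `{∞, (tγt⁻¹)∞} − {∞, γ∞}`, `t`- and `T_p`-stable (`p ≠ 3`), with its OWN restricted operators
  `shiftOne`, `heckeOne` (and their rules), `(1 − t)² = −3t` on `Λ₁`, the mod-`3` exactness on `Λ₁`, the
  period map on `Λ₁` (`ev_f(ty − y) = ev_{f∣t − f}(y)`; `ev_f` kills `Λ_B` when `f + f∣t + f∣t² = 0`), and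
  the mod-`R` fibre `ShiftSubOneModule N h9 R = R ⊗ Λ₁` (`V₁ = Λ₁/3Λ₁` for `R = 𝔽₃` — NOT a subspace of
  `H(N; 𝔽₃)`) with `shiftOneR`, `heckeOneR`, their rules, and its (generalised) isotypic pieces
  `isotypicOne`, `genIsotypicOne` (Mathlib `maxGenEigenspace`); element identities on `R ⊗ Λ₁` are left
  to be pulled back from `Λ₁` (they are heartbeat-heavy to elaborate directly);
* **Hecke-isotypic pieces** `isotypic N R S a = ⋂_{p ∈ S} ker(T_p − a_p) ⊆ H(N; R)` for a system of
  eigenvalues `a : ℕ → R` on a set `S` of primes, stable under all `T_q` and (if `3 ∉ S`) under `Nm`,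
  with the **semilinear twist of `1 − t`**: for `x ∈ isotypic S a`, `T_p((1 − t)x) = a_p (1 − t)x` if
  `p ≡ 1 (mod 3)` and `= a_p (1 + t)(1 − t)x` if `p ≡ 2 (mod 3)`; hence in characteristic `3` on the
  Prym part (where `(1 − t)² = 0`, so `(1 + t)y = −y` for `y ∈ (1 − t)·prym`):
  `T_p((1 − t)x) = χ₋₃(p) a_p (1 − t)x`.

All statements are PROVED (no named facts). Not here: the Galois action (hypothesis structure
`ModularJacobianGaloisData`), Hilbert 90 / Chevalley–Weil for the cover (the cell's items (α)/(L1)),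
Serre weights ((β)/(L2)), cusp-difference classes and Manin–Drinfeld (request (4), not typed), any
rank/dimension count (the rank of `Λ` is the tree's named fact `periodHomology_eq_span_basis`).

## References

* M. Harrison, *Explicit automorphisms of `X₀(108)`* (2011), §2 (the order-`3` automorphism
  `S₃ : τ ↦ τ + 1/3` of `X₀(N)`, `9 ∣ N`).
* H. Darmon, F. Diamond, R. Taylor, *Fermat's Last Theorem* (1995), §1.3 pp. 27, 32 (`J = V/Λ`;
  endomorphisms of `V/Λ` from `V`; `J[n] = n⁻¹Λ/Λ`).
* J. E. Cremona, *Algorithms for modular elliptic curves* (1992/1997), §2.1, §2.4 (homology, Hecke action).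
-/

noncomputable section

open scoped MatrixGroups ModularForm TensorProduct

open CongruenceSubgroup
open Literature.NumberTheory.EllipticCurves.ModularForms

namespace Literature.NumberTheory.ModularSymbols

/-! ### The norm `Nm = 1 + t_* + t_*²` on `V = S₂(Γ₀(N))^∨` -/

section NormDual

variable (N : ℕ) [NeZero N] (h9 : 3 ^ 2 ∣ N)

/-- **The norm `Nm = 1 + t_* + t_*²` of the shift on `V = S₂(Γ₀(N))^∨`** (`9 ∣ N`): for the cyclic triple
cover `π : X₀(N) → X₀(N)/⟨t⟩` one has `π^*π_* = 1 + t_* + t_*²`. [cite: Harrison2011X0108, §2] -/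
def normDual : Module.End ℂ (Module.Dual ℂ (CuspForm (Gamma0 N) 2)) :=
  1 + shiftDual N h9 + shiftDual N h9 * shiftDual N h9

/-- `Nm φ = φ + t_*φ + t_*²φ`. [cite: Harrison2011X0108, §2] -/
theorem normDual_apply (φ : Module.Dual ℂ (CuspForm (Gamma0 N) 2)) :
    normDual N h9 φ = φ + shiftDual N h9 φ + shiftDual N h9 (shiftDual N h9 φ) :=
  rfl

/-- `t_*³ = 1` in `End(V)`. [cite: Harrison2011X0108, §2] -/
theorem shiftDual_pow_three : shiftDual N h9 ^ 3 = 1 :=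
  LinearMap.ext fun φ ↦ by
    simp only [pow_three, Module.End.mul_apply, Module.End.one_apply, shiftDual_shiftDual_shiftDual]

/-- `t_* · Nm = Nm` on `V`. [cite: Harrison2011X0108, §2] -/
theorem shiftDual_mul_normDual : shiftDual N h9 * normDual N h9 = normDual N h9 :=
  LinearMap.ext fun φ ↦ by
    simp only [Module.End.mul_apply, normDual_apply, map_add, shiftDual_shiftDual_shiftDual]
    abel

/-- `Nm · t_* = Nm` on `V`. [cite: Harrison2011X0108, §2] -/
theorem normDual_mul_shiftDual : normDual N h9 * shiftDual N h9 = normDual N h9 :=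
  LinearMap.ext fun φ ↦ by
    simp only [Module.End.mul_apply, normDual_apply, shiftDual_shiftDual_shiftDual]
    abel

/-- `Nm` preserves the period homology `Λ ⊆ V`. [cite: DarmonDiamondTaylor1995, §1.3 (p. 32)] -/
theorem normDual_mem_periodHomology {φ : Module.Dual ℂ (CuspForm (Gamma0 N) 2)}
    (hφ : φ ∈ periodHomology N) : normDual N h9 φ ∈ periodHomology N := by
  rw [normDual_apply]
  exact add_mem (add_mem hφ (shiftDual_mem_periodHomology N h9 hφ))
    (shiftDual_mem_periodHomology N h9 (shiftDual_mem_periodHomology N h9 hφ))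

variable {N} in
/-- `t_* T_p^∨ = T_p^∨ t_*` on `V` for `p ≡ 1 (mod 3)` (transpose of `T_p(f ∣ t) = (T_p f) ∣ t`).
[cite: DiamondShurman2005, Prop. 5.2.2(a) (derived reading via q-expansions, see `heckeT_shiftCuspForm_of_mod_three_eq_one`)] -/
theorem shiftDual_dualMap_heckeT_of_mod_three_eq_one {p : ℕ} [NeZero p] (hp : p.Prime) (hp1 : p % 3 = 1)
    (φ : Module.Dual ℂ (CuspForm (Gamma0 N) 2)) :
    shiftDual N h9 ((heckeT (Gamma0 N) 2 p).dualMap φ) = (heckeT (Gamma0 N) 2 p).dualMap (shiftDual N h9 φ) := by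
  refine LinearMap.ext fun f ↦ ?_
  change φ (heckeT (Gamma0 N) 2 p (shiftCuspForm N h9 f)) = φ (shiftCuspForm N h9 (heckeT (Gamma0 N) 2 p f))
  rw [heckeT_shiftCuspForm_of_mod_three_eq_one h9 hp hp1]

variable {N} in
/-- `t_* T_p^∨ = T_p^∨ t_*²` on `V` for `p ≡ 2 (mod 3)` (transpose of `T_p(f ∣ t) = (T_p f) ∣ t²`).
[cite: DiamondShurman2005, Prop. 5.2.2(a) (derived reading via q-expansions, see `heckeT_shiftCuspForm_of_mod_three_eq_two`)] -/
theorem shiftDual_dualMap_heckeT_of_mod_three_eq_two {p : ℕ} [NeZero p] (hp : p.Prime) (hp2 : p % 3 = 2)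
    (φ : Module.Dual ℂ (CuspForm (Gamma0 N) 2)) :
    shiftDual N h9 ((heckeT (Gamma0 N) 2 p).dualMap φ) =
      (heckeT (Gamma0 N) 2 p).dualMap (shiftDual N h9 (shiftDual N h9 φ)) := by
  refine LinearMap.ext fun f ↦ ?_
  change φ (heckeT (Gamma0 N) 2 p (shiftCuspForm N h9 f)) =
    φ (shiftCuspForm N h9 (shiftCuspForm N h9 (heckeT (Gamma0 N) 2 p f)))
  rw [heckeT_shiftCuspForm_of_mod_three_eq_two h9 hp hp2]

variable {N} in
/-- **`Nm` commutes with `T_p^∨` on `V` for every prime `p ≠ 3`** (`T_p` or `U_p`): for `p ≡ 1 (mod 3)`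
each of `1, t_*, t_*²` commutes with `T_p^∨`; for `p ≡ 2 (mod 3)`, `t_* T_p^∨ = T_p^∨ t_*²` and
`t_*² T_p^∨ = T_p^∨ t_*⁴ = T_p^∨ t_*`, so the sum `1 + t_* + t_*²` commutes.
[cite: DiamondShurman2005, Prop. 5.2.2(a) (derived reading, see `heckeT_shiftCuspForm_of_mod_three_eq_one/two`)] -/
theorem normDual_dualMap_heckeT {p : ℕ} [NeZero p] (hp : p.Prime) (hp3 : p ≠ 3)
    (φ : Module.Dual ℂ (CuspForm (Gamma0 N) 2)) :
    normDual N h9 ((heckeT (Gamma0 N) 2 p).dualMap φ) = (heckeT (Gamma0 N) 2 p).dualMap (normDual N h9 φ) := by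
  have hmod : p % 3 = 1 ∨ p % 3 = 2 := by
    have h0 : p % 3 ≠ 0 := fun h0 ↦
      hp3 ((Nat.prime_dvd_prime_iff_eq Nat.prime_three hp).mp (Nat.dvd_of_mod_eq_zero h0)).symm
    have hlt : p % 3 < 3 := Nat.mod_lt _ (by norm_num)
    omega
  rw [normDual_apply, normDual_apply, map_add, map_add]
  rcases hmod with h1 | h2
  · rw [shiftDual_dualMap_heckeT_of_mod_three_eq_one h9 hp h1,
      shiftDual_dualMap_heckeT_of_mod_three_eq_one h9 hp h1]
  · have hA := shiftDual_dualMap_heckeT_of_mod_three_eq_two h9 hp h2 φ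
    have hB : shiftDual N h9 (shiftDual N h9 ((heckeT (Gamma0 N) 2 p).dualMap φ)) =
        (heckeT (Gamma0 N) 2 p).dualMap (shiftDual N h9 φ) := by
      rw [hA, shiftDual_dualMap_heckeT_of_mod_three_eq_two h9 hp h2, shiftDual_shiftDual_shiftDual,
        ← shiftDual_shiftDual_shiftDual N h9 (shiftDual N h9 φ), shiftDual_shiftDual_shiftDual]
    rw [hB, hA]
    abel

end NormDual

/-! ### The norm on `Λ = H₁(X₀(N), ℤ)`; the Prym lattice `Λ_P` and the fixed lattice `Λ_B` -/

section NormInt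

variable (N : ℕ) [NeZero N] (h9 : 3 ^ 2 ∣ N)

/-- **`Nm = 1 + t_* + t_*²` on `Λ = H₁(X₀(N), ℤ)`** (restriction of `normDual`). [cite: Harrison2011X0108, §2] -/
def normInt : Module.End ℤ (periodHomologyHecke N) :=
  1 + shiftInt N h9 + shiftInt N h9 * shiftInt N h9

/-- `Nm x = x + t_*x + t_*²x` on `Λ`. [cite: Harrison2011X0108, §2] -/
theorem normInt_apply (x : periodHomologyHecke N) :
    normInt N h9 x = x + shiftInt N h9 x + shiftInt N h9 (shiftInt N h9 x) :=
  rfl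

/-- The functional underlying `Nm x` is `Nm` of the functional. [cite: Harrison2011X0108, §2] -/
@[simp] theorem coe_normInt_apply (x : periodHomologyHecke N) :
    (normInt N h9 x : Module.Dual ℂ (CuspForm (Gamma0 N) 2)) =
      normDual N h9 (x : Module.Dual ℂ (CuspForm (Gamma0 N) 2)) := by
  rw [normInt_apply, normDual_apply, Submodule.coe_add, Submodule.coe_add, coe_shiftInt, coe_shiftInt,
    coe_shiftInt]

/-- `t · Nm = Nm` on `Λ`. [cite: Harrison2011X0108, §2] -/
theorem shiftInt_mul_normInt : shiftInt N h9 * normInt N h9 = normInt N h9 :=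
  LinearMap.ext fun x ↦ by
    simp only [Module.End.mul_apply, normInt_apply, map_add, shiftInt_shiftInt_shiftInt]
    abel

/-- `Nm · t = Nm` on `Λ`. [cite: Harrison2011X0108, §2] -/
theorem normInt_mul_shiftInt : normInt N h9 * shiftInt N h9 = normInt N h9 :=
  LinearMap.ext fun x ↦ by
    simp only [Module.End.mul_apply, normInt_apply, shiftInt_shiftInt_shiftInt]
    abel

/-- `(t − 1) · Nm = 0` on `Λ`: the image of `Nm` is `t`-fixed. [cite: Harrison2011X0108, §2] -/
theorem shiftInt_sub_one_mul_normInt : (shiftInt N h9 - 1) * normInt N h9 = 0 := by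
  rw [sub_mul, one_mul, shiftInt_mul_normInt, sub_self]

/-- `Nm · (t − 1) = 0` on `Λ`: the image of `t − 1` lies in `ker Nm`. [cite: Harrison2011X0108, §2] -/
theorem normInt_mul_shiftInt_sub_one : normInt N h9 * (shiftInt N h9 - 1) = 0 := by
  rw [mul_sub, mul_one, normInt_mul_shiftInt, sub_self]

/-- **`3 = Nm + (1 − t)(2 + t)`** in `End(Λ)` (`(1 − t)(2 + t) = 2 − t − t²`). [cite: Harrison2011X0108, §2] -/
theorem three_eq_normInt_add :
    (3 : Module.End ℤ (periodHomologyHecke N)) = normInt N h9 + (1 - shiftInt N h9) * (2 + shiftInt N h9) :=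
  LinearMap.ext fun x ↦ by
    simp only [Module.End.ofNat_apply, LinearMap.add_apply, Module.End.mul_apply, LinearMap.sub_apply,
      Module.End.one_apply, normInt_apply, map_add, map_nsmul]
    abel

/-- **`(1 − t)² = Nm − 3t`** in `End(Λ)`. [cite: Harrison2011X0108, §2] -/
theorem one_sub_shiftInt_sq :
    (1 - shiftInt N h9) ^ 2 = normInt N h9 - 3 * shiftInt N h9 :=
  LinearMap.ext fun x ↦ by
    simp only [sq, Module.End.mul_apply, LinearMap.sub_apply, Module.End.one_apply, normInt_apply, map_sub,
      Module.End.ofNat_apply]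
    abel

variable {N} in
/-- **`Nm` commutes with `T_p` on `Λ` for every prime `p ≠ 3`.**
[cite: DiamondShurman2005, Prop. 5.2.2(a) (derived reading, see `normDual_dualMap_heckeT`)] -/
theorem normInt_smul_T {p : ℕ} (hp : p.Prime) (hp3 : p ≠ 3) (x : periodHomologyHecke N) :
    normInt N h9 (HeckeRing0.T N 2 p hp • x) = HeckeRing0.T N 2 p hp • normInt N h9 x := by
  haveI : NeZero p := ⟨hp.ne_zero⟩
  apply Subtype.ext
  rw [coe_normInt_apply, Submodule.coe_smul, Submodule.coe_smul, coe_normInt_apply]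
  exact normDual_dualMap_heckeT h9 hp hp3 _

/-- **The Prym lattice `Λ_P := ker(Nm) = Λ ∩ ker(1 + t_* + t_*²) ⊆ H₁(X₀(N), ℤ)`** — the integral
homology of the Prym part of the triple cover `X₀(N) → X₀(N)/⟨t⟩` (memo LINE23 §13.6 (h): "`P := im(1 − t)`,
`Λ_P = ker(1 + t + t²)` primitive"). [cite: Harrison2011X0108, §2] -/
def prymLattice : Submodule ℤ (periodHomologyHecke N) :=
  LinearMap.ker (normInt N h9)

/-- **The fixed lattice `Λ_B := ker(t_* − 1) = Λ^{t} ⊆ H₁(X₀(N), ℤ)`** (the `t`-invariant integral classes;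
"`= Λ ∩ π^*H₁(X₀(N/3))`"). [cite: Harrison2011X0108, §2] -/
def fixedLattice : Submodule ℤ (periodHomologyHecke N) :=
  LinearMap.ker (shiftInt N h9 - 1)

/-- `x ∈ Λ_P ↔ Nm x = 0`. [cite: Harrison2011X0108, §2] -/
theorem mem_prymLattice_iff (x : periodHomologyHecke N) : x ∈ prymLattice N h9 ↔ normInt N h9 x = 0 :=
  LinearMap.mem_ker

/-- `x ∈ Λ_B ↔ t x = x`. [cite: Harrison2011X0108, §2] -/
theorem mem_fixedLattice_iff (x : periodHomologyHecke N) : x ∈ fixedLattice N h9 ↔ shiftInt N h9 x = x := by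
  rw [fixedLattice, LinearMap.mem_ker, LinearMap.sub_apply, Module.End.one_apply, sub_eq_zero]

/-- `Nm Λ ⊆ Λ_B`: norms are `t`-fixed. [cite: Harrison2011X0108, §2] -/
theorem normInt_mem_fixedLattice (x : periodHomologyHecke N) : normInt N h9 x ∈ fixedLattice N h9 := by
  rw [mem_fixedLattice_iff, ← Module.End.mul_apply, shiftInt_mul_normInt]

/-- `(1 − t)Λ ⊆ Λ_P`. [cite: Harrison2011X0108, §2] -/
theorem sub_shiftInt_mem_prymLattice (x : periodHomologyHecke N) : x - shiftInt N h9 x ∈ prymLattice N h9 := by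
  rw [mem_prymLattice_iff, map_sub, ← Module.End.mul_apply, normInt_mul_shiftInt, sub_self]

/-- `Λ_P` is `t`-stable. [cite: Harrison2011X0108, §2] -/
theorem shiftInt_mem_prymLattice {x : periodHomologyHecke N} (hx : x ∈ prymLattice N h9) :
    shiftInt N h9 x ∈ prymLattice N h9 := by
  rw [mem_prymLattice_iff] at hx ⊢
  rw [← Module.End.mul_apply, normInt_mul_shiftInt, hx]

/-- `Λ_B` is `t`-stable (trivially). [cite: Harrison2011X0108, §2] -/
theorem shiftInt_mem_fixedLattice {x : periodHomologyHecke N} (hx : x ∈ fixedLattice N h9) :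
    shiftInt N h9 x ∈ fixedLattice N h9 := by
  rw [mem_fixedLattice_iff] at hx ⊢
  rw [hx]
  exact hx

variable {N} in
/-- `Λ_P` is `T_p`-stable for every prime `p ≠ 3`. [cite: DiamondShurman2005, Prop. 5.2.2(a) (derived reading, see `normInt_smul_T`)] -/
theorem T_smul_mem_prymLattice {p : ℕ} (hp : p.Prime) (hp3 : p ≠ 3) {x : periodHomologyHecke N}
    (hx : x ∈ prymLattice N h9) : HeckeRing0.T N 2 p hp • x ∈ prymLattice N h9 := by
  rw [mem_prymLattice_iff] at hx ⊢
  rw [normInt_smul_T h9 hp hp3, hx, smul_zero]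

variable {N} in
/-- `Λ_B` is `T_p`-stable for every prime `p ≠ 3` (`t T_p x = T_p t^{±1} x = T_p x` for `t x = x`).
[cite: DiamondShurman2005, Prop. 5.2.2(a) (derived reading, see `shiftInt_smul_T_of_mod_three_eq_one/two`)] -/
theorem T_smul_mem_fixedLattice {p : ℕ} (hp : p.Prime) (hp3 : p ≠ 3) {x : periodHomologyHecke N}
    (hx : x ∈ fixedLattice N h9) : HeckeRing0.T N 2 p hp • x ∈ fixedLattice N h9 := by
  rw [mem_fixedLattice_iff] at hx ⊢
  have hmod : p % 3 = 1 ∨ p % 3 = 2 := by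
    have h0 : p % 3 ≠ 0 := fun h0 ↦
      hp3 ((Nat.prime_dvd_prime_iff_eq Nat.prime_three hp).mp (Nat.dvd_of_mod_eq_zero h0)).symm
    have hlt : p % 3 < 3 := Nat.mod_lt _ (by norm_num)
    omega
  rcases hmod with h1 | h2
  · rw [shiftInt_smul_T_of_mod_three_eq_one N h9 hp h1, hx]
  · rw [shiftInt_smul_T_of_mod_three_eq_two N h9 hp h2, hx, hx]

/-- `Λ` is torsion-free as an additive group (it sits in the `ℂ`-vector space `V`).
[cite: DarmonDiamondTaylor1995, §1.3 (p. 27)] -/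
theorem isAddTorsionFree_periodHomologyHecke : IsAddTorsionFree (periodHomologyHecke N) := by
  haveI : IsAddTorsionFree (Module.Dual ℂ (CuspForm (Gamma0 N) 2)) :=
    IsAddTorsionFree.of_isTorsionFree ℂ _
  exact Function.Injective.isAddTorsionFree (periodHomologyHecke N).subtype.toAddMonoidHom
    Subtype.val_injective

/-- **`Λ_B ∩ Λ_P = 0`**: a `t`-fixed class with norm `0` satisfies `3x = Nm x = 0`, and `Λ` is torsion-free.
[cite: Harrison2011X0108, §2] -/
theorem fixedLattice_inf_prymLattice : fixedLattice N h9 ⊓ prymLattice N h9 = ⊥ := by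
  haveI := isAddTorsionFree_periodHomologyHecke N
  rw [eq_bot_iff]
  rintro x ⟨hB, hP⟩
  rw [SetLike.mem_coe, mem_fixedLattice_iff] at hB
  rw [SetLike.mem_coe, mem_prymLattice_iff, normInt_apply, hB, hB] at hP
  have h3 : 3 • x = 0 := by
    rw [← hP]
    abel
  rw [Submodule.mem_bot]
  exact (nsmul_eq_zero_iff_right (by norm_num : (3 : ℕ) ≠ 0)).mp h3

/-- **`3Λ ⊆ Λ_B + Λ_P`** (`3x = Nm x + (1 − t)(2 + t)x`): `Λ_B ⊕ Λ_P` has finite `3`-power index in `Λ`.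
[cite: Harrison2011X0108, §2] -/
theorem three_smul_mem_sup (x : periodHomologyHecke N) : 3 • x ∈ fixedLattice N h9 ⊔ prymLattice N h9 := by
  have h := congrArg (fun u : Module.End ℤ (periodHomologyHecke N) ↦ u x) (three_eq_normInt_add N h9)
  simp only [Module.End.ofNat_apply, LinearMap.add_apply, Module.End.mul_apply] at h
  rw [h]
  refine Submodule.add_mem_sup (normInt_mem_fixedLattice N h9 x) ?_
  have := sub_shiftInt_mem_prymLattice N h9 ((2 + shiftInt N h9) x)
  rwa [LinearMap.sub_apply, Module.End.one_apply]

/-- **`Λ_P` is saturated (primitive)**: `n x ∈ Λ_P ↔ x ∈ Λ_P` for `n ≠ 0`. [cite: Harrison2011X0108, §2] -/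
theorem smul_mem_prymLattice_iff {n : ℤ} (hn : n ≠ 0) (x : periodHomologyHecke N) :
    n • x ∈ prymLattice N h9 ↔ x ∈ prymLattice N h9 := by
  haveI := isAddTorsionFree_periodHomologyHecke N
  rw [mem_prymLattice_iff, mem_prymLattice_iff, map_zsmul, IsAddTorsionFree.zsmul_eq_zero_iff_right hn]

/-- **`Λ_B` is saturated (primitive)**: `n x ∈ Λ_B ↔ x ∈ Λ_B` for `n ≠ 0`. [cite: Harrison2011X0108, §2] -/
theorem smul_mem_fixedLattice_iff {n : ℤ} (hn : n ≠ 0) (x : periodHomologyHecke N) :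
    n • x ∈ fixedLattice N h9 ↔ x ∈ fixedLattice N h9 := by
  haveI := isAddTorsionFree_periodHomologyHecke N
  rw [fixedLattice, LinearMap.mem_ker, LinearMap.mem_ker, map_zsmul, IsAddTorsionFree.zsmul_eq_zero_iff_right hn]

/-- **`(1 − t)² = −3t` on `Λ_P`**: for `x ∈ Λ_P`, `(1 − t)((1 − t)x) = −3·t x` (since `Nm x = 0`; memo LINE23
§13.6 (h): "`(1 − t)² = −3t` on `P`"). [cite: Harrison2011X0108, §2] -/
theorem one_sub_shiftInt_sq_apply_of_mem_prymLattice {x : periodHomologyHecke N} (hx : x ∈ prymLattice N h9) :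
    (1 - shiftInt N h9) ((1 - shiftInt N h9) x) = -(3 • shiftInt N h9 x) := by
  have h := congrArg (fun u : Module.End ℤ (periodHomologyHecke N) ↦ u x) (one_sub_shiftInt_sq N h9)
  simp only [sq, Module.End.mul_apply, LinearMap.sub_apply, Module.End.ofNat_apply] at h
  rw [(mem_prymLattice_iff N h9 x).mp hx, zero_sub] at h
  exact h

/-- **`1 − t` is injective on `Λ_P`** (`Λ_B ∩ Λ_P = 0`). [cite: Harrison2011X0108, §2] -/
theorem eq_zero_of_mem_prymLattice_of_shiftInt_eq {x : periodHomologyHecke N} (hx : x ∈ prymLattice N h9)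
    (h : shiftInt N h9 x = x) : x = 0 := by
  have hx' : x ∈ fixedLattice N h9 ⊓ prymLattice N h9 := ⟨(mem_fixedLattice_iff N h9 x).mpr h, hx⟩
  rw [fixedLattice_inf_prymLattice] at hx'
  exact (Submodule.mem_bot ℤ).mp hx'

/-- **`3Λ_P ⊆ (1 − t)Λ_P`**: for `y ∈ Λ_P`, `3y = (1 − t)((1 − t)(−t²y))` with `−t²y ∈ Λ_P`
(`(1 − t)²(−t²y) = −3t(−t²y) = 3t³y = 3y`). [cite: Harrison2011X0108, §2] -/
theorem exists_three_smul_eq_of_mem_prymLattice {y : periodHomologyHecke N} (hy : y ∈ prymLattice N h9) :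
    ∃ z ∈ prymLattice N h9, 3 • y = (1 - shiftInt N h9) ((1 - shiftInt N h9) z) := by
  refine ⟨-(shiftInt N h9 (shiftInt N h9 y)),
    neg_mem (shiftInt_mem_prymLattice N h9 (shiftInt_mem_prymLattice N h9 hy)), ?_⟩
  rw [one_sub_shiftInt_sq_apply_of_mem_prymLattice N h9
    (neg_mem (shiftInt_mem_prymLattice N h9 (shiftInt_mem_prymLattice N h9 hy))),
    map_neg, shiftInt_shiftInt_shiftInt, smul_neg, neg_neg]

/-- **Mod-`3` exactness on the Prym lattice** (`ker(1 − t̄) = im(1 − t̄)` on `Λ_P/3Λ_P`): for `x ∈ Λ_P`,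
`(1 − t)x ∈ 3Λ_P` iff `x ∈ (1 − t)Λ_P`. (⇐: `(1 − t)²z = −3tz`. ⇒: from `(1 − t)x = 3y` apply `1 − t`:
`−3tx = 3(1 − t)y`, cancel `3` (torsion-free): `−tx = (1 − t)y`, so `x = (1 − t)(−t²y)`.)
[cite: Harrison2011X0108, §2] -/
theorem exists_sub_shiftInt_eq_three_smul_iff {x : periodHomologyHecke N} (hx : x ∈ prymLattice N h9) :
    (∃ y ∈ prymLattice N h9, (1 - shiftInt N h9) x = 3 • y) ↔
      ∃ z ∈ prymLattice N h9, x = (1 - shiftInt N h9) z := by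
  haveI := isAddTorsionFree_periodHomologyHecke N
  constructor
  · rintro ⟨y, hy, hxy⟩
    -- apply `1 − t`: `(1 − t)²x = 3(1 − t)y`, i.e. `−3·t x = 3·(1 − t)y`
    have h1 : (1 - shiftInt N h9) ((1 - shiftInt N h9) x) = 3 • (1 - shiftInt N h9) y := by
      rw [hxy, map_nsmul]
    rw [one_sub_shiftInt_sq_apply_of_mem_prymLattice N h9 hx, ← neg_nsmul] at h1
    have h2 : -shiftInt N h9 x = (1 - shiftInt N h9) y :=
      nsmul_right_injective (by norm_num : (3 : ℕ) ≠ 0) h1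
    -- `x = t²(t x) = −t²((1 − t)y) = (1 − t)(−t²y)`
    refine ⟨-(shiftInt N h9 (shiftInt N h9 y)),
      neg_mem (shiftInt_mem_prymLattice N h9 (shiftInt_mem_prymLattice N h9 hy)), ?_⟩
    have h3 : x = shiftInt N h9 (shiftInt N h9 (shiftInt N h9 x)) := (shiftInt_shiftInt_shiftInt N h9 x).symm
    rw [h3, ← neg_neg (shiftInt N h9 x), map_neg, map_neg, h2]
    simp only [LinearMap.sub_apply, Module.End.one_apply, map_sub, map_neg, shiftInt_shiftInt_shiftInt]
  · rintro ⟨z, hz, rfl⟩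
    refine ⟨-(shiftInt N h9 z), neg_mem (shiftInt_mem_prymLattice N h9 hz), ?_⟩
    rw [one_sub_shiftInt_sq_apply_of_mem_prymLattice N h9 hz, smul_neg]

end NormInt

/-! ### The norm, the Prym part and the fixed part of `H(N; R) = R ⊗ Λ` -/

section NormR

variable (N : ℕ) [NeZero N] (h9 : 3 ^ 2 ∣ N) (R : Type*) [CommRing R]

/-- `ℕ`-multiples: `n x ∈ Λ_P ↔ x ∈ Λ_P` for `n ≠ 0` (saturation). [cite: Harrison2011X0108, §2] -/
theorem nsmul_mem_prymLattice_iff {n : ℕ} (hn : n ≠ 0) (x : periodHomologyHecke N) :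
    n • x ∈ prymLattice N h9 ↔ x ∈ prymLattice N h9 := by
  rw [← Nat.cast_smul_eq_nsmul ℤ, smul_mem_prymLattice_iff N h9 (by exact_mod_cast hn)]

/-- **The norm `Nm = 1 + t + t²` on `H(N; R)`** (`9 ∣ N`). [cite: Harrison2011X0108, §2] -/
def norm : Module.End R (CuspidalHomologyHeckeModule N R) :=
  1 + shift N h9 R + shift N h9 R * shift N h9 R

/-- `Nm x = x + t x + t²x` on `H(N; R)`. [cite: Harrison2011X0108, §2] -/
theorem norm_apply (x : CuspidalHomologyHeckeModule N R) :
    norm N h9 R x = x + shift N h9 R x + shift N h9 R (shift N h9 R x) :=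
  rfl

/-- `Nm (r ⊗ x) = r ⊗ Nm x`: the norm on `H(N; R)` is the base change of the integral one.
[cite: Harrison2011X0108, §2] -/
@[simp] theorem norm_tmul (r : R) (x : periodHomologyHecke N) :
    norm N h9 R (r ⊗ₜ[ℤ] x) = r ⊗ₜ[ℤ] normInt N h9 x := by
  rw [norm_apply, normInt_apply, shift_tmul, shift_tmul, TensorProduct.tmul_add, TensorProduct.tmul_add]

/-- `Nm = (normInt) ⊗ 1`. [cite: Harrison2011X0108, §2] -/
theorem norm_eq_baseChange : norm N h9 R = (normInt N h9).baseChange R :=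
  TensorProduct.AlgebraTensorModule.ext fun r x ↦ by rw [norm_tmul, LinearMap.baseChange_tmul]

/-- `t · Nm = Nm` on `H(N; R)`. [cite: Harrison2011X0108, §2] -/
theorem shift_mul_norm : shift N h9 R * norm N h9 R = norm N h9 R :=
  LinearMap.ext fun x ↦ by
    simp only [Module.End.mul_apply, norm_apply, map_add, shift_shift_shift]
    abel

/-- `Nm · t = Nm` on `H(N; R)`. [cite: Harrison2011X0108, §2] -/
theorem norm_mul_shift : norm N h9 R * shift N h9 R = norm N h9 R :=
  LinearMap.ext fun x ↦ by
    simp only [Module.End.mul_apply, norm_apply, shift_shift_shift]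
    abel

/-- `(t − 1) · Nm = 0` on `H(N; R)`. [cite: Harrison2011X0108, §2] -/
theorem shift_sub_one_mul_norm : (shift N h9 R - 1) * norm N h9 R = 0 := by
  rw [sub_mul, one_mul, shift_mul_norm, sub_self]

/-- `Nm · (t − 1) = 0` on `H(N; R)`. [cite: Harrison2011X0108, §2] -/
theorem norm_mul_shift_sub_one : norm N h9 R * (shift N h9 R - 1) = 0 := by
  rw [mul_sub, mul_one, norm_mul_shift, sub_self]

/-- **`3 = Nm + (1 − t)(2 + t)`** in `End_R H(N; R)`. [cite: Harrison2011X0108, §2] -/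
theorem three_eq_norm_add :
    (3 : Module.End R (CuspidalHomologyHeckeModule N R)) = norm N h9 R + (1 - shift N h9 R) * (2 + shift N h9 R) :=
  LinearMap.ext fun x ↦ by
    simp only [Module.End.ofNat_apply, LinearMap.add_apply, Module.End.mul_apply, LinearMap.sub_apply,
      Module.End.one_apply, norm_apply, map_add, map_nsmul]
    abel

/-- **`(1 − t)² = Nm − 3t`** in `End_R H(N; R)`. [cite: Harrison2011X0108, §2] -/
theorem one_sub_shift_sq : (1 - shift N h9 R) ^ 2 = norm N h9 R - 3 * shift N h9 R :=
  LinearMap.ext fun x ↦ by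
    simp only [sq, Module.End.mul_apply, LinearMap.sub_apply, Module.End.one_apply, norm_apply, map_sub,
      Module.End.ofNat_apply]
    abel

variable {N R} in
/-- **`Nm` commutes with `T_p` on `H(N; R)` for every prime `p ≠ 3`.**
[cite: DiamondShurman2005, Prop. 5.2.2(a) (derived reading, see `normInt_smul_T`)] -/
theorem norm_comp_heckeOp {p : ℕ} (hp : p.Prime) (hp3 : p ≠ 3) :
    norm N h9 R ∘ₗ heckeOp N R p hp = heckeOp N R p hp ∘ₗ norm N h9 R := by
  refine TensorProduct.AlgebraTensorModule.ext fun r x ↦ ?_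
  simp only [LinearMap.comp_apply, heckeOp_tmul, norm_tmul, normInt_smul_T h9 hp hp3]

/-- **The Prym part `prym = ker(Nm) ⊆ H(N; R)`** (memo LINE23 §13.6 (h): `V_P`, the Prym side of
`X₀(N) → X₀(N)/⟨t⟩`). [cite: Harrison2011X0108, §2] -/
def prym : Submodule R (CuspidalHomologyHeckeModule N R) :=
  LinearMap.ker (norm N h9 R)

/-- **The `t`-fixed part `fixedPart = ker(t − 1) ⊆ H(N; R)`** ("`π^*`-side"). [cite: Harrison2011X0108, §2] -/
def fixedPart : Submodule R (CuspidalHomologyHeckeModule N R) :=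
  LinearMap.ker (shift N h9 R - 1)

/-- `x ∈ prym ↔ Nm x = 0`. [cite: Harrison2011X0108, §2] -/
theorem mem_prym_iff (x : CuspidalHomologyHeckeModule N R) : x ∈ prym N h9 R ↔ norm N h9 R x = 0 :=
  LinearMap.mem_ker

/-- `x ∈ fixedPart ↔ t x = x`. [cite: Harrison2011X0108, §2] -/
theorem mem_fixedPart_iff (x : CuspidalHomologyHeckeModule N R) :
    x ∈ fixedPart N h9 R ↔ shift N h9 R x = x := by
  rw [fixedPart, LinearMap.mem_ker, LinearMap.sub_apply, Module.End.one_apply, sub_eq_zero]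

/-- `Nm x` is `t`-fixed. [cite: Harrison2011X0108, §2] -/
theorem norm_mem_fixedPart (x : CuspidalHomologyHeckeModule N R) : norm N h9 R x ∈ fixedPart N h9 R := by
  rw [mem_fixedPart_iff, ← Module.End.mul_apply, shift_mul_norm]

/-- `x − t x ∈ prym`. [cite: Harrison2011X0108, §2] -/
theorem sub_shift_mem_prym (x : CuspidalHomologyHeckeModule N R) : x - shift N h9 R x ∈ prym N h9 R := by
  rw [mem_prym_iff, map_sub, ← Module.End.mul_apply, norm_mul_shift, sub_self]

/-- `prym` is `t`-stable. [cite: Harrison2011X0108, §2] -/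
theorem shift_mem_prym {x : CuspidalHomologyHeckeModule N R} (hx : x ∈ prym N h9 R) :
    shift N h9 R x ∈ prym N h9 R := by
  rw [mem_prym_iff] at hx ⊢
  rw [← Module.End.mul_apply, norm_mul_shift, hx]

/-- `r ⊗ x ∈ prym` for `x ∈ Λ_P`. [cite: Harrison2011X0108, §2] -/
theorem tmul_mem_prym {x : periodHomologyHecke N} (hx : x ∈ prymLattice N h9) (r : R) :
    r ⊗ₜ[ℤ] x ∈ prym N h9 R := by
  rw [mem_prym_iff, norm_tmul, (mem_prymLattice_iff N h9 x).mp hx, TensorProduct.tmul_zero]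

/-- `r ⊗ x ∈ fixedPart` for `x ∈ Λ_B`. [cite: Harrison2011X0108, §2] -/
theorem tmul_mem_fixedPart {x : periodHomologyHecke N} (hx : x ∈ fixedLattice N h9) (r : R) :
    r ⊗ₜ[ℤ] x ∈ fixedPart N h9 R := by
  rw [mem_fixedPart_iff, shift_tmul, (mem_fixedLattice_iff N h9 x).mp hx]

/-- **`3·H(N; R) ⊆ fixedPart + prym`** (`3x = Nm x + (1 − t)(2 + t)x`). [cite: Harrison2011X0108, §2] -/
theorem three_smul_mem_fixedPart_sup_prym (x : CuspidalHomologyHeckeModule N R) :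
    3 • x ∈ fixedPart N h9 R ⊔ prym N h9 R := by
  have h := congrArg (fun u : Module.End R (CuspidalHomologyHeckeModule N R) ↦ u x) (three_eq_norm_add N h9 R)
  simp only [Module.End.ofNat_apply, LinearMap.add_apply, Module.End.mul_apply] at h
  rw [h]
  refine Submodule.add_mem_sup (norm_mem_fixedPart N h9 R x) ?_
  have := sub_shift_mem_prym N h9 R ((2 + shift N h9 R) x)
  rwa [LinearMap.sub_apply, Module.End.one_apply]

variable {N R} in
/-- `prym` is `T_p`-stable for every prime `p ≠ 3`.
[cite: DiamondShurman2005, Prop. 5.2.2(a) (derived reading, see `norm_comp_heckeOp`)] -/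
theorem heckeOp_mem_prym {p : ℕ} (hp : p.Prime) (hp3 : p ≠ 3) {x : CuspidalHomologyHeckeModule N R}
    (hx : x ∈ prym N h9 R) : heckeOp N R p hp x ∈ prym N h9 R := by
  rw [mem_prym_iff] at hx ⊢
  rw [← LinearMap.comp_apply, norm_comp_heckeOp h9 hp hp3, LinearMap.comp_apply, hx, map_zero]

variable {N R} in
/-- `fixedPart` is `T_p`-stable for every prime `p ≠ 3`.
[cite: DiamondShurman2005, Prop. 5.2.2(a) (derived reading, see `shift_comp_heckeOp_of_mod_three_eq_one/two`)] -/
theorem heckeOp_mem_fixedPart {p : ℕ} (hp : p.Prime) (hp3 : p ≠ 3) {x : CuspidalHomologyHeckeModule N R}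
    (hx : x ∈ fixedPart N h9 R) : heckeOp N R p hp x ∈ fixedPart N h9 R := by
  rw [mem_fixedPart_iff] at hx ⊢
  have hmod : p % 3 = 1 ∨ p % 3 = 2 := by
    have h0 : p % 3 ≠ 0 := fun h0 ↦
      hp3 ((Nat.prime_dvd_prime_iff_eq Nat.prime_three hp).mp (Nat.dvd_of_mod_eq_zero h0)).symm
    have hlt : p % 3 < 3 := Nat.mod_lt _ (by norm_num)
    omega
  rcases hmod with h1 | h2
  · have h := congrArg (fun u ↦ u x) (shift_comp_heckeOp_of_mod_three_eq_one N h9 R hp h1)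
    simp only [LinearMap.comp_apply, hx] at h
    exact h
  · have h := congrArg (fun u ↦ u x) (shift_comp_heckeOp_of_mod_three_eq_two N h9 R hp h2)
    simp only [LinearMap.comp_apply, hx] at h
    exact h

/-- In characteristic `3` the scalar `3` acts as `0` on `H(N; R)`. [cite: HatcherAT2002, §3.A Cor. 3A.4] -/
theorem three_eq_zero_of_charP [CharP R 3] : (3 : Module.End R (CuspidalHomologyHeckeModule N R)) = 0 := by
  have h3 : (3 : R) = 0 := by simpa using CharP.cast_eq_zero R 3
  rw [← map_ofNat (algebraMap R (Module.End R (CuspidalHomologyHeckeModule N R))) 3, h3, map_zero]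

/-- **In characteristic `3`: `Nm = (1 − t)²`** on `H(N; R)` (`t` is unipotent mod `3`).
[cite: Harrison2011X0108, §2] -/
theorem norm_eq_one_sub_shift_sq_of_charP [CharP R 3] : norm N h9 R = (1 - shift N h9 R) ^ 2 := by
  rw [one_sub_shift_sq, three_eq_zero_of_charP, zero_mul, sub_zero]

/-- In characteristic `3`, `fixedPart ≤ prym` (`t x = x ⇒ (1 − t)²x = 0 = Nm x`). [cite: Harrison2011X0108, §2] -/
theorem fixedPart_le_prym_of_charP [CharP R 3] : fixedPart N h9 R ≤ prym N h9 R := by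
  intro x hx
  rw [mem_fixedPart_iff] at hx
  rw [mem_prym_iff, norm_eq_one_sub_shift_sq_of_charP]
  simp only [sq, Module.End.mul_apply, LinearMap.sub_apply, Module.End.one_apply, hx, sub_self, map_zero]

/-- **In characteristic `3`, `(1 − t)² = 0` on the Prym part** (memo LINE23 §13.6 (h): "`(1 − t)² ≡ 0 mod 3`
on `P`"). [cite: Harrison2011X0108, §2] -/
theorem sub_shift_sub_shift_eq_zero_of_charP [CharP R 3] {x : CuspidalHomologyHeckeModule N R}
    (hx : x ∈ prym N h9 R) :
    (x - shift N h9 R x) - shift N h9 R (x - shift N h9 R x) = 0 := by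
  rw [mem_prym_iff, norm_eq_one_sub_shift_sq_of_charP] at hx
  simpa only [sq, Module.End.mul_apply, LinearMap.sub_apply, Module.End.one_apply] using hx

end NormR

/-! ### Hecke-isotypic pieces of `H(N; R)` and the semilinear twist of `1 − t` -/

section Isotypic

variable (N : ℕ) [NeZero N] (R : Type*) [CommRing R]

/-- **The isotypic piece `H(N; R)[a] := ⋂_{p ∈ S} ker(T_p − a_p)`** of a system of Hecke eigenvalues
`a : ℕ → R` on a set `S` of primes (typically `S = {p : p ∤ 3N}` or `S ∌ 3`; for a maximal ideal `𝔪` of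
`𝕋` with residue field `𝔽₃`, `H(N; 𝔽₃)[𝔪] = isotypic N (ZMod 3) S (a mod 3)`). [cite: DiamondShurman2005, §6.3] -/
def isotypic (S : Set ℕ) (a : ℕ → R) : Submodule R (CuspidalHomologyHeckeModule N R) :=
  ⨅ (p : ℕ), ⨅ (hp : p.Prime), ⨅ (_ : p ∈ S),
    LinearMap.ker (heckeOp N R p hp - a p • (1 : Module.End R (CuspidalHomologyHeckeModule N R)))

/-- `x ∈ H(N; R)[a] ↔ T_p x = a_p x` for all primes `p ∈ S`. [cite: DiamondShurman2005, §6.3] -/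
theorem mem_isotypic_iff {S : Set ℕ} {a : ℕ → R} (x : CuspidalHomologyHeckeModule N R) :
    x ∈ isotypic N R S a ↔ ∀ (p : ℕ) (hp : p.Prime), p ∈ S → heckeOp N R p hp x = a p • x := by
  simp only [isotypic, Submodule.mem_iInf, LinearMap.mem_ker, LinearMap.sub_apply, LinearMap.smul_apply,
    Module.End.one_apply, sub_eq_zero]

/-- Isotypic pieces are stable under every `T_q` (`𝕋` is commutative). [cite: DiamondShurman2005, Prop. 5.2.4] -/
theorem heckeOp_mem_isotypic {S : Set ℕ} {a : ℕ → R} (q : ℕ) (hq : q.Prime) {x : CuspidalHomologyHeckeModule N R}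
    (hx : x ∈ isotypic N R S a) : heckeOp N R q hq x ∈ isotypic N R S a := by
  rw [mem_isotypic_iff] at hx ⊢
  intro p hp hpS
  rw [← LinearMap.comp_apply, heckeOp_comm, LinearMap.comp_apply, hx p hp hpS, map_smul]

/-- Isotypic pieces away from `3` are stable under `Nm` (`9 ∣ N`).
[cite: DiamondShurman2005, Prop. 5.2.2(a) (derived reading, see `norm_comp_heckeOp`)] -/
theorem norm_mem_isotypic (h9 : 3 ^ 2 ∣ N) {S : Set ℕ} (h3 : 3 ∉ S) {a : ℕ → R}
    {x : CuspidalHomologyHeckeModule N R} (hx : x ∈ isotypic N R S a) : norm N h9 R x ∈ isotypic N R S a := by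
  rw [mem_isotypic_iff] at hx ⊢
  intro p hp hpS
  have hp3 : p ≠ 3 := fun h ↦ h3 (h ▸ hpS)
  rw [← LinearMap.comp_apply, ← norm_comp_heckeOp h9 hp hp3, LinearMap.comp_apply, hx p hp hpS, map_smul]

variable (h9 : 3 ^ 2 ∣ N)

variable {N R} in
/-- **`T_p (1 − t) = (1 − t) T_p` on eigenvectors, `p ≡ 1 (mod 3)`**: `T_p x = c x ⇒ T_p(x − t x) = c(x − t x)`.
[cite: DiamondShurman2005, Prop. 5.2.2(a) (derived reading, see `shift_comp_heckeOp_of_mod_three_eq_one`)] -/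
theorem heckeOp_sub_shift_of_mod_three_eq_one {p : ℕ} (hp : p.Prime) (hp1 : p % 3 = 1)
    {x : CuspidalHomologyHeckeModule N R} {c : R} (hx : heckeOp N R p hp x = c • x) :
    heckeOp N R p hp (x - shift N h9 R x) = c • (x - shift N h9 R x) := by
  have h := congrArg (fun u ↦ u x) (shift_comp_heckeOp_of_mod_three_eq_one N h9 R hp hp1)
  simp only [LinearMap.comp_apply, hx, map_smul] at h
  rw [map_sub, hx, ← h, smul_sub]

variable {N R} in
/-- **The semilinear twist for `p ≡ 2 (mod 3)`**: `T_p x = c x ⇒ T_p(x − t x) = c(x − t²x) = c(1 + t)(x − t x)`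
(`T_p t = t² T_p`). [cite: DiamondShurman2005, Prop. 5.2.2(a) (derived reading, see `heckeOp_comp_shift_of_mod_three_eq_two`)] -/
theorem heckeOp_sub_shift_of_mod_three_eq_two {p : ℕ} (hp : p.Prime) (hp2 : p % 3 = 2)
    {x : CuspidalHomologyHeckeModule N R} {c : R} (hx : heckeOp N R p hp x = c • x) :
    heckeOp N R p hp (x - shift N h9 R x) =
      c • ((x - shift N h9 R x) + shift N h9 R (x - shift N h9 R x)) := by
  have h := congrArg (fun u ↦ u x) (heckeOp_comp_shift_of_mod_three_eq_two N h9 R hp hp2)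
  simp only [LinearMap.comp_apply, hx, map_smul] at h
  rw [map_sub, hx, h, map_sub]
  simp only [smul_sub, smul_add]
  abel

variable {N R} in
/-- **In characteristic `3`, on the Prym part, `1 − t` twists the eigenvalue by `χ₋₃(p)`**: for
`x ∈ prym` with `T_p x = c x` and `p ≡ 2 (mod 3)`, `T_p (x − t x) = −c (x − t x)` (as `(1 − t)² = 0` on
`prym` gives `t y = y` for `y = x − t x`, and `2 = −1`). Memo LINE23 §13.7 (γ): "`1 − t` induces
`V/Φ ≅ Φ^χ`, Hecke-semilinear". [cite: DiamondShurman2005, Prop. 5.2.2(a) (derived reading, see `heckeOp_comp_shift_of_mod_three_eq_two`)] -/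
theorem heckeOp_sub_shift_of_mod_three_eq_two_of_charP [CharP R 3] {p : ℕ} (hp : p.Prime) (hp2 : p % 3 = 2)
    {x : CuspidalHomologyHeckeModule N R} (hxP : x ∈ prym N h9 R) {c : R} (hx : heckeOp N R p hp x = c • x) :
    heckeOp N R p hp (x - shift N h9 R x) = (-c) • (x - shift N h9 R x) := by
  have hfix : shift N h9 R (x - shift N h9 R x) = x - shift N h9 R x := by
    have h0 := sub_shift_sub_shift_eq_zero_of_charP N h9 R hxP
    rwa [sub_eq_zero, eq_comm] at h0
  have h2 : (2 : R) = -1 := by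
    have h3 : (3 : R) = 0 := by simpa using CharP.cast_eq_zero R 3
    linear_combination h3
  rw [heckeOp_sub_shift_of_mod_three_eq_two h9 hp hp2 hx, hfix, ← two_smul R (x - shift N h9 R x), smul_smul,
    mul_comm, h2, neg_one_mul]

variable {N R} in
/-- **Isotypic form of the twist (characteristic `3`, `3 ∉ S`)**: for `x ∈ H(N; R)[a] ∩ prym`,
`x − t x ∈ H(N; R)[χ₋₃·a]` with `(χ₋₃·a)_p = a_p` for `p ≡ 1`, `−a_p` for `p ≡ 2 (mod 3)`.
[cite: DiamondShurman2005, Prop. 5.2.2(a) (derived reading, see `heckeOp_sub_shift_of_mod_three_eq_two_of_charP`)] -/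
theorem sub_shift_mem_isotypic_twist_of_charP [CharP R 3] {S : Set ℕ} (h3 : 3 ∉ S) {a : ℕ → R}
    {x : CuspidalHomologyHeckeModule N R} (hx : x ∈ isotypic N R S a) (hxP : x ∈ prym N h9 R) :
    x - shift N h9 R x ∈ isotypic N R S (fun p ↦ if p % 3 = 1 then a p else -a p) := by
  rw [mem_isotypic_iff] at hx ⊢
  intro p hp hpS
  have hp3 : p ≠ 3 := fun h ↦ h3 (h ▸ hpS)
  have hmod : p % 3 = 1 ∨ p % 3 = 2 := by
    have h0 : p % 3 ≠ 0 := fun h0 ↦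
      hp3 ((Nat.prime_dvd_prime_iff_eq Nat.prime_three hp).mp (Nat.dvd_of_mod_eq_zero h0)).symm
    have hlt : p % 3 < 3 := Nat.mod_lt _ (by norm_num)
    omega
  rcases hmod with h1 | h2
  · rw [if_pos h1]
    exact heckeOp_sub_shift_of_mod_three_eq_one h9 hp h1 (hx p hp hpS)
  · rw [if_neg (by omega)]
    exact heckeOp_sub_shift_of_mod_three_eq_two_of_charP h9 hp h2 hxP (hx p hp hpS)

end Isotypic

/-! ### On the Jacobian `J₀(N)(ℂ) = V/Λ`: `Nm`, `B = Nm(J)`, the Prym torus `P`, and `Λ_P/nΛ_P ≅ P[n]` -/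

section Jacobian

variable (N : ℕ) [NeZero N] (h9 : 3 ^ 2 ∣ N)

/-- **The norm `Nm = 1 + t_* + t_*²` on `J₀(N)(ℂ) = V/Λ`** (`= π^*π_*` for `π : X₀(N) → X₀(N)/⟨t⟩`).
[cite: DarmonDiamondTaylor1995, §1.3 (p. 32)] -/
def jacobianNorm : J0 N →+ J0 N :=
  (J0.shift N h9).comp (J0.shift N h9) + J0.shift N h9 + AddMonoidHom.id (J0 N)

/-- `Nm z = t²z + t z + z` on `J₀(N)(ℂ)`. [cite: DarmonDiamondTaylor1995, §1.3 (p. 32)] -/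
theorem jacobianNorm_apply (z : J0 N) :
    jacobianNorm N h9 z = J0.shift N h9 (J0.shift N h9 z) + J0.shift N h9 z + z :=
  rfl

/-- `Nm [φ] = [Nm φ]`. [cite: DarmonDiamondTaylor1995, §1.3 (p. 32)] -/
theorem jacobianNorm_mk (φ : Module.Dual ℂ (CuspForm (Gamma0 N) 2)) :
    jacobianNorm N h9 (Submodule.Quotient.mk φ) = Submodule.Quotient.mk (normDual N h9 φ) := by
  rw [jacobianNorm_apply, J0.shift_mk, J0.shift_mk, normDual_apply, Submodule.Quotient.mk_add,
    Submodule.Quotient.mk_add]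
  abel

/-- `t (Nm z) = Nm z`: norms are `t`-fixed. [cite: DarmonDiamondTaylor1995, §1.3 (p. 32)] -/
theorem shift_jacobianNorm (z : J0 N) : J0.shift N h9 (jacobianNorm N h9 z) = jacobianNorm N h9 z := by
  obtain ⟨φ, rfl⟩ := Submodule.Quotient.mk_surjective (periodHomologyHecke N) z
  rw [jacobianNorm_mk, J0.shift_mk, ← Module.End.mul_apply, shiftDual_mul_normDual]

/-- `Nm (t z) = Nm z`. [cite: DarmonDiamondTaylor1995, §1.3 (p. 32)] -/
theorem jacobianNorm_shift (z : J0 N) : jacobianNorm N h9 (J0.shift N h9 z) = jacobianNorm N h9 z := by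
  obtain ⟨φ, rfl⟩ := Submodule.Quotient.mk_surjective (periodHomologyHecke N) z
  rw [J0.shift_mk, jacobianNorm_mk, jacobianNorm_mk, ← Module.End.mul_apply, normDual_mul_shiftDual]

/-- **`B := Nm(J₀(N)(ℂ))`** — for the triple cover `π`, `π^*J(X₀(N)/⟨t⟩) = π^*π_*J₀(N) = Nm J₀(N)` (`π_*`
is surjective), so this is "`π^*J₀(N/3)`" without degeneracy maps (memo LINE23 §13.7: `B := π^*J_Y`).
[cite: DarmonDiamondTaylor1995, §1.3 (p. 32)] -/
def normRange : AddSubgroup (J0 N) :=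
  (jacobianNorm N h9).range

/-- **The Prym torus `P := image of ker(Nm | V)` in `J₀(N)(ℂ) = V/Λ`** (the connected part of `ker Nm`;
memo LINE23 §13.6 (h): `P := im(1 − t)`, the Prym of `X₀(N) → X₀(N)/⟨t⟩`). [cite: DarmonDiamondTaylor1995, §1.3 (p. 32)] -/
def prymTorus : AddSubgroup (J0 N) :=
  (LinearMap.ker (normDual N h9)).toAddSubgroup.map (periodHomologyHecke N).mkQ.toAddMonoidHom

/-- `z ∈ P ↔ z = [φ]` for some `φ ∈ V` with `Nm φ = 0`. [cite: DarmonDiamondTaylor1995, §1.3 (p. 32)] -/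
theorem mem_prymTorus_iff (z : J0 N) :
    z ∈ prymTorus N h9 ↔ ∃ φ : Module.Dual ℂ (CuspForm (Gamma0 N) 2), normDual N h9 φ = 0 ∧
      Submodule.Quotient.mk φ = z := by
  simp only [prymTorus, AddSubgroup.mem_map, Submodule.mem_toAddSubgroup, LinearMap.mem_ker,
    LinearMap.toAddMonoidHom_coe, Submodule.mkQ_apply]

/-- Elements of `B` are `t`-fixed. [cite: DarmonDiamondTaylor1995, §1.3 (p. 32)] -/
theorem shift_eq_self_of_mem_normRange {z : J0 N} (hz : z ∈ normRange N h9) : J0.shift N h9 z = z := by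
  obtain ⟨w, rfl⟩ := hz
  exact shift_jacobianNorm N h9 w

/-- `Nm` kills the Prym torus. [cite: DarmonDiamondTaylor1995, §1.3 (p. 32)] -/
theorem jacobianNorm_eq_zero_of_mem_prymTorus {z : J0 N} (hz : z ∈ prymTorus N h9) : jacobianNorm N h9 z = 0 := by
  obtain ⟨φ, hφ, rfl⟩ := (mem_prymTorus_iff N h9 z).mp hz
  rw [jacobianNorm_mk, hφ, Submodule.Quotient.mk_zero]

/-- The Prym torus is `t`-stable. [cite: DarmonDiamondTaylor1995, §1.3 (p. 32)] -/
theorem shift_mem_prymTorus {z : J0 N} (hz : z ∈ prymTorus N h9) : J0.shift N h9 z ∈ prymTorus N h9 := by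
  obtain ⟨φ, hφ, rfl⟩ := (mem_prymTorus_iff N h9 z).mp hz
  rw [J0.shift_mk, mem_prymTorus_iff]
  refine ⟨shiftDual N h9 φ, ?_, rfl⟩
  rw [← Module.End.mul_apply, normDual_mul_shiftDual, hφ]

/-- `[φ − t_*φ] ∈ P` for every `φ ∈ V`: `(1 − t)J₀(N) ⊆ P`. [cite: DarmonDiamondTaylor1995, §1.3 (p. 32)] -/
theorem mk_sub_shiftDual_mem_prymTorus (φ : Module.Dual ℂ (CuspForm (Gamma0 N) 2)) :
    Submodule.Quotient.mk (p := periodHomologyHecke N) (φ - shiftDual N h9 φ) ∈ prymTorus N h9 := by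
  rw [mem_prymTorus_iff]
  refine ⟨φ - shiftDual N h9 φ, ?_, rfl⟩
  rw [map_sub, ← Module.End.mul_apply, normDual_mul_shiftDual, sub_self]

/-- **`3·J₀(N)(ℂ) ⊆ B + P`** (`3z = Nm z + (1 − t)(2 + t)z`). [cite: DarmonDiamondTaylor1995, §1.3 (p. 32)] -/
theorem three_smul_mem_normRange_sup_prymTorus (z : J0 N) : 3 • z ∈ normRange N h9 ⊔ prymTorus N h9 := by
  obtain ⟨φ, rfl⟩ := Submodule.Quotient.mk_surjective (periodHomologyHecke N) z
  have hV : normDual N h9 φ + ((2 • φ + shiftDual N h9 φ) - shiftDual N h9 (2 • φ + shiftDual N h9 φ)) =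
      3 • φ := by
    rw [normDual_apply, map_add, map_nsmul]
    abel
  have hdec : (3 • Submodule.Quotient.mk φ : J0 N) =
      jacobianNorm N h9 (Submodule.Quotient.mk φ) +
        Submodule.Quotient.mk ((2 • φ + shiftDual N h9 φ) - shiftDual N h9 (2 • φ + shiftDual N h9 φ)) := by
    rw [jacobianNorm_mk, ← Submodule.Quotient.mk_add, hV]
    exact (map_nsmul (periodHomologyHecke N).mkQ 3 φ).symm
  rw [hdec]
  exact AddSubgroup.add_mem_sup ⟨_, rfl⟩ (mk_sub_shiftDual_mem_prymTorus N h9 _)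

/-- **The mod-`n` fibre map `Λ_P → J₀(N)(ℂ)`, `x ↦ [n⁻¹x]`** (values in `P ∩ J₀(N)[n]`; kernel `nΛ_P`;
onto `P[n]` — `Λ_P/nΛ_P ≅ P[n]`, the Prym analogue of `J₀(N)[n] = n⁻¹Λ/Λ`, Darmon–Diamond–Taylor §1.3
p. 27 and the tree's `J0.divMap` / `J0.exists_linearDivMap`). [cite: DarmonDiamondTaylor1995, §1.3 (p. 27)] -/
def prymDivMap (n : ℕ) : prymLattice N h9 →+ J0 N where
  toFun x := Submodule.Quotient.mk
    ((n : ℂ)⁻¹ • ((x : periodHomologyHecke N) : Module.Dual ℂ (CuspForm (Gamma0 N) 2)))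
  map_zero' := by simp
  map_add' x y := by
    simp only [Submodule.coe_add, smul_add, Submodule.Quotient.mk_add]

/-- Unfolding `prymDivMap`. [cite: DarmonDiamondTaylor1995, §1.3 (p. 27)] -/
theorem prymDivMap_apply (n : ℕ) (x : prymLattice N h9) :
    prymDivMap N h9 n x = Submodule.Quotient.mk
      ((n : ℂ)⁻¹ • ((x : periodHomologyHecke N) : Module.Dual ℂ (CuspForm (Gamma0 N) 2))) :=
  rfl

/-- `[n⁻¹x] ∈ P` for `x ∈ Λ_P`. [cite: DarmonDiamondTaylor1995, §1.3 (p. 27)] -/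
theorem prymDivMap_mem_prymTorus (n : ℕ) (x : prymLattice N h9) : prymDivMap N h9 n x ∈ prymTorus N h9 := by
  rw [prymDivMap_apply, mem_prymTorus_iff]
  refine ⟨_, ?_, rfl⟩
  rw [map_smul, ← coe_normInt_apply, (mem_prymLattice_iff N h9 _).mp x.2, Submodule.coe_zero, smul_zero]

/-- `n · [n⁻¹x] = [x] = 0`: the fibre map lands in `J₀(N)[n]`. [cite: DarmonDiamondTaylor1995, §1.3 (p. 27)] -/
theorem nsmul_prymDivMap (n : ℕ) (x : prymLattice N h9) : n • prymDivMap N h9 n x = 0 := by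
  rcases eq_or_ne n 0 with rfl | hn
  · simp
  have hn' : (n : ℂ) ≠ 0 := Nat.cast_ne_zero.mpr hn
  rw [prymDivMap_apply, ← Submodule.mkQ_apply, ← map_nsmul, Submodule.mkQ_apply, Submodule.Quotient.mk_eq_zero,
    mem_periodHomologyHecke, ← Nat.cast_smul_eq_nsmul ℂ, smul_smul, mul_inv_cancel₀ hn', one_smul]
  exact (x : periodHomologyHecke N).2

/-- **Kernel of the fibre map: `[n⁻¹x] = 0 ↔ x ∈ nΛ_P`** (`n ≠ 0`; uses that `Λ_P` is saturated in `Λ`).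
[cite: DarmonDiamondTaylor1995, §1.3 (p. 27)] -/
theorem prymDivMap_eq_zero_iff {n : ℕ} (hn : n ≠ 0) (x : prymLattice N h9) :
    prymDivMap N h9 n x = 0 ↔ ∃ y : prymLattice N h9, x = n • y := by
  have hn' : (n : ℂ) ≠ 0 := Nat.cast_ne_zero.mpr hn
  rw [prymDivMap_apply, Submodule.Quotient.mk_eq_zero, mem_periodHomologyHecke]
  constructor
  · intro h
    -- `λ := n⁻¹x ∈ Λ` with `n·λ = x ∈ Λ_P`, so `λ ∈ Λ_P` by saturation
    set lam : periodHomologyHecke N := ⟨_, h⟩ with hlam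
    have hnl : n • lam = (x : periodHomologyHecke N) := by
      apply Subtype.ext
      rw [Submodule.coe_smul_of_tower, hlam, ← Nat.cast_smul_eq_nsmul ℂ, smul_smul, mul_inv_cancel₀ hn',
        one_smul]
    have hlamP : lam ∈ prymLattice N h9 := by
      rw [← nsmul_mem_prymLattice_iff N h9 hn, hnl]
      exact x.2
    refine ⟨⟨lam, hlamP⟩, Subtype.ext ?_⟩
    rw [Submodule.coe_smul_of_tower, hnl]
  · rintro ⟨y, rfl⟩
    rw [Submodule.coe_smul_of_tower, Submodule.coe_smul_of_tower, ← Nat.cast_smul_eq_nsmul ℂ, smul_smul,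
      inv_mul_cancel₀ hn', one_smul]
    exact (y : periodHomologyHecke N).2

/-- **The fibre map is onto `P[n]`**: every `n`-torsion point of the Prym torus is `[n⁻¹x]` with `x ∈ Λ_P`
(`n ≠ 0`: if `z = [φ]`, `Nm φ = 0`, `nz = 0`, then `x := nφ ∈ Λ ∩ ker Nm = Λ_P`). [cite: DarmonDiamondTaylor1995, §1.3 (p. 27)] -/
theorem exists_prymDivMap_eq {n : ℕ} (hn : n ≠ 0) {z : J0 N} (hz : z ∈ prymTorus N h9) (hnz : n • z = 0) :
    ∃ x : prymLattice N h9, prymDivMap N h9 n x = z := by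
  have hn' : (n : ℂ) ≠ 0 := Nat.cast_ne_zero.mpr hn
  obtain ⟨φ, hφ, rfl⟩ := (mem_prymTorus_iff N h9 z).mp hz
  rw [← Submodule.mkQ_apply, ← map_nsmul, Submodule.mkQ_apply, Submodule.Quotient.mk_eq_zero,
    mem_periodHomologyHecke] at hnz
  have hP : (⟨n • φ, hnz⟩ : periodHomologyHecke N) ∈ prymLattice N h9 := by
    rw [mem_prymLattice_iff]
    apply Subtype.ext
    rw [coe_normInt_apply, Submodule.coe_zero, map_nsmul, hφ, smul_zero]
  refine ⟨⟨_, hP⟩, ?_⟩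
  rw [prymDivMap_apply]
  change Submodule.Quotient.mk ((n : ℂ)⁻¹ • (n • φ)) = Submodule.Quotient.mk φ
  rw [← Nat.cast_smul_eq_nsmul ℂ, smul_smul, inv_mul_cancel₀ hn', one_smul]

/-- **The fibre map is `t`-equivariant**: `t[n⁻¹x] = [n⁻¹ t x]`. [cite: DarmonDiamondTaylor1995, §1.3 (p. 32)] -/
theorem shift_prymDivMap (n : ℕ) (x : prymLattice N h9) :
    J0.shift N h9 (prymDivMap N h9 n x) =
      prymDivMap N h9 n ⟨shiftInt N h9 x, shiftInt_mem_prymLattice N h9 x.2⟩ := by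
  rw [prymDivMap_apply, prymDivMap_apply, jacobianShift_mk_smul]

/-- **The fibre map is Hecke-equivariant**: `T[n⁻¹x] = [n⁻¹ T x]` for `T ∈ 𝕋_ℤ` (for `T = T_p`, `p ≠ 3`,
the right-hand side is again a value of the fibre map, `T_smul_mem_prymLattice`).
[cite: DarmonDiamondTaylor1995, §1.3 (p. 32)] -/
theorem T_smul_prymDivMap (T : HeckeRing0 N 2) (n : ℕ) (x : prymLattice N h9) :
    T • prymDivMap N h9 n x = Submodule.Quotient.mk
      ((n : ℂ)⁻¹ • ((T • (x : periodHomologyHecke N) : periodHomologyHecke N) :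
        Module.Dual ℂ (CuspForm (Gamma0 N) 2))) := by
  rw [prymDivMap_apply, ← Submodule.Quotient.mk_smul, Submodule.coe_smul]
  congr 1

/-- **Transport of the `t`-fixed part**: `[n⁻¹x]` is `t`-fixed iff `(t − 1)x ∈ nΛ_P` (`n ≠ 0`). For `n = 3`
this identifies the `t`-fixed Prym `3`-torsion `Φ` (memo LINE23 §13.6 (h)) with
`ker(1 − t̄) = im(1 − t̄) ⊆ Λ_P/3Λ_P` (`exists_sub_shiftInt_eq_three_smul_iff`).
[cite: DarmonDiamondTaylor1995, §1.3 (p. 32)] -/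
theorem shift_prymDivMap_eq_self_iff {n : ℕ} (hn : n ≠ 0) (x : prymLattice N h9) :
    J0.shift N h9 (prymDivMap N h9 n x) = prymDivMap N h9 n x ↔
      ∃ y : prymLattice N h9, (⟨shiftInt N h9 x - x,
        sub_mem (shiftInt_mem_prymLattice N h9 x.2) x.2⟩ : prymLattice N h9) = n • y := by
  rw [shift_prymDivMap, ← sub_eq_zero, ← map_sub, prymDivMap_eq_zero_iff N h9 hn]
  constructor
  · rintro ⟨y, hy⟩
    refine ⟨y, ?_⟩
    rw [← hy]
    rfl
  · rintro ⟨y, hy⟩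
    refine ⟨y, ?_⟩
    rw [← hy]
    rfl

end Jacobian

/-! ### The lattice `Λ₁ = (t − 1)Λ ⊆ Λ_P`, its own operators, and its mod-`R` fibre `R ⊗ Λ₁`
(bsd-idea-3 post35: `Λ₁ := range(t_* − 1)`, "`Λ₁ ⊗ ℝ/Λ₁ ≅ J/B`"; `V₁ = Λ₁/3Λ₁` is NOT a subspace of
`H(N; 𝔽₃)` since `Λ₁` is not saturated, so it gets its own carrier `R ⊗ Λ₁`) -/

section ShiftSubOne

variable (N : ℕ) [NeZero N] (h9 : 3 ^ 2 ∣ N)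

/-- **`Λ₁ := (t − 1)Λ = range(t_* − 1) ⊆ H₁(X₀(N), ℤ)`** (`9 ∣ N`): the lattice spanned by the differences
`{∞, (tγt⁻¹)∞} − {∞, γ∞}`; `3Λ_P ⊆ Λ₁ ⊆ Λ_P` (memo LINE23 §13.10: `Λ₁ ⊗ ℝ/Λ₁ ≅ J₀(N)/B`).
[cite: Harrison2011X0108, §2] -/
def shiftSubOneLattice : Submodule ℤ (periodHomologyHecke N) :=
  LinearMap.range (shiftInt N h9 - 1)

/-- `x ∈ Λ₁ ↔ x = t y − y` for some `y ∈ Λ`. [cite: Harrison2011X0108, §2] -/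
theorem mem_shiftSubOneLattice_iff (x : periodHomologyHecke N) :
    x ∈ shiftSubOneLattice N h9 ↔ ∃ y : periodHomologyHecke N, shiftInt N h9 y - y = x := by
  simp only [shiftSubOneLattice, LinearMap.mem_range, LinearMap.sub_apply, Module.End.one_apply]

/-- `t y − y ∈ Λ₁`. [cite: Harrison2011X0108, §2] -/
theorem shiftInt_sub_mem_shiftSubOneLattice (y : periodHomologyHecke N) :
    shiftInt N h9 y - y ∈ shiftSubOneLattice N h9 :=
  (mem_shiftSubOneLattice_iff N h9 _).mpr ⟨y, rfl⟩

/-- **`Λ₁ ⊆ Λ_P`** (`Nm·(t − 1) = 0`). [cite: Harrison2011X0108, §2] -/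
theorem shiftSubOneLattice_le_prymLattice : shiftSubOneLattice N h9 ≤ prymLattice N h9 := by
  rintro x ⟨y, rfl⟩
  rw [mem_prymLattice_iff, ← Module.End.mul_apply, normInt_mul_shiftInt_sub_one, LinearMap.zero_apply]

/-- **`3Λ_P ⊆ Λ₁`** (`3y = (1 − t)²(−t²y)` for `y ∈ Λ_P`): `Λ₁` has `3`-power index in `Λ_P`.
[cite: Harrison2011X0108, §2] -/
theorem three_smul_mem_shiftSubOneLattice {y : periodHomologyHecke N} (hy : y ∈ prymLattice N h9) :
    3 • y ∈ shiftSubOneLattice N h9 := by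
  obtain ⟨z, -, hz⟩ := exists_three_smul_eq_of_mem_prymLattice N h9 hy
  rw [hz, mem_shiftSubOneLattice_iff]
  refine ⟨-((1 - shiftInt N h9) z), ?_⟩
  simp only [LinearMap.sub_apply, Module.End.one_apply, map_sub, neg_sub]
  abel

/-- The symbol differences `{∞, (tγt⁻¹)∞} − {∞, γ∞}` lie in (indeed generate) `Λ₁`. [cite: Manin1972, Prop. 1.4] -/
theorem symbolInt_shiftConj_sub_mem_shiftSubOneLattice (γ : Gamma0 N) :
    symbolInt N (shiftConj N h9 γ) - symbolInt N γ ∈ shiftSubOneLattice N h9 := by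
  rw [← shiftInt_symbolInt]
  exact shiftInt_sub_mem_shiftSubOneLattice N h9 _

/-- `Λ₁` is `t`-stable (`t(ty − y) = t(ty) − ty`). [cite: Harrison2011X0108, §2] -/
theorem shiftInt_mem_shiftSubOneLattice {x : periodHomologyHecke N} (hx : x ∈ shiftSubOneLattice N h9) :
    shiftInt N h9 x ∈ shiftSubOneLattice N h9 := by
  obtain ⟨y, rfl⟩ := (mem_shiftSubOneLattice_iff N h9 x).mp hx
  rw [map_sub]
  exact shiftInt_sub_mem_shiftSubOneLattice N h9 _

variable {N} in
/-- `Λ₁` is `T_p`-stable for every prime `p ≠ 3` (`T_p(ty − y) = t^{±1}T_p y − T_p y`, and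
`t²w − w = (t(tw) − tw) + (tw − w)`). [cite: DiamondShurman2005, Prop. 5.2.2(a) (derived reading, see `shiftInt_smul_T_of_mod_three_eq_one/two`)] -/
theorem T_smul_mem_shiftSubOneLattice {p : ℕ} (hp : p.Prime) (hp3 : p ≠ 3) {x : periodHomologyHecke N}
    (hx : x ∈ shiftSubOneLattice N h9) : HeckeRing0.T N 2 p hp • x ∈ shiftSubOneLattice N h9 := by
  obtain ⟨y, rfl⟩ := (mem_shiftSubOneLattice_iff N h9 x).mp hx
  have hmod : p % 3 = 1 ∨ p % 3 = 2 := by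
    have h0 : p % 3 ≠ 0 := fun h0 ↦
      hp3 ((Nat.prime_dvd_prime_iff_eq Nat.prime_three hp).mp (Nat.dvd_of_mod_eq_zero h0)).symm
    have hlt : p % 3 < 3 := Nat.mod_lt _ (by norm_num)
    omega
  rw [smul_sub]
  rcases hmod with h1 | h2
  · rw [← shiftInt_smul_T_of_mod_three_eq_one N h9 hp h1]
    exact shiftInt_sub_mem_shiftSubOneLattice N h9 _
  · rw [smul_T_shiftInt_of_mod_three_eq_two N h9 hp h2]
    have e : shiftInt N h9 (shiftInt N h9 (HeckeRing0.T N 2 p hp • y)) - HeckeRing0.T N 2 p hp • y =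
        (shiftInt N h9 (shiftInt N h9 (HeckeRing0.T N 2 p hp • y)) - shiftInt N h9 (HeckeRing0.T N 2 p hp • y)) +
          (shiftInt N h9 (HeckeRing0.T N 2 p hp • y) - HeckeRing0.T N 2 p hp • y) := by abel
    rw [e]
    exact add_mem (shiftInt_sub_mem_shiftSubOneLattice N h9 _) (shiftInt_sub_mem_shiftSubOneLattice N h9 _)

/-- **`t` restricted to `Λ₁`**, as a `ℤ`-linear endomorphism of `Λ₁`. [cite: Harrison2011X0108, §2] -/
def shiftOne : Module.End ℤ (shiftSubOneLattice N h9) where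
  toFun x := ⟨shiftInt N h9 x, shiftInt_mem_shiftSubOneLattice N h9 x.2⟩
  map_add' x y := Subtype.ext (by simp only [Submodule.coe_add, map_add])
  map_smul' n x := Subtype.ext (by simp only [Submodule.coe_smul_of_tower, map_zsmul, eq_intCast, Int.cast_id])

/-- Unfolding `shiftOne`. [cite: Harrison2011X0108, §2] -/
@[simp] theorem coe_shiftOne (x : shiftSubOneLattice N h9) :
    ((shiftOne N h9 x : shiftSubOneLattice N h9) : periodHomologyHecke N) = shiftInt N h9 x :=
  rfl

/-- `t³ = 1` on `Λ₁`. [cite: Harrison2011X0108, §2] -/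
theorem shiftOne_shiftOne_shiftOne (x : shiftSubOneLattice N h9) :
    shiftOne N h9 (shiftOne N h9 (shiftOne N h9 x)) = x :=
  Subtype.ext (shiftInt_shiftInt_shiftInt N h9 x)

/-- **`(1 − t)² = −3t` on `Λ₁`** (as on all of `Λ_P`). [cite: Harrison2011X0108, §2] -/
theorem one_sub_shiftOne_sq_apply (x : shiftSubOneLattice N h9) :
    (1 - shiftOne N h9) ((1 - shiftOne N h9) x) = -(3 • shiftOne N h9 x) := by
  apply Subtype.ext
  have h := one_sub_shiftInt_sq_apply_of_mem_prymLattice N h9 (shiftSubOneLattice_le_prymLattice N h9 x.2)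
  simpa only [LinearMap.sub_apply, Module.End.one_apply, Submodule.coe_sub, Submodule.coe_neg,
    Submodule.coe_smul_of_tower, coe_shiftOne, map_sub] using h

/-- **Mod-`3` exactness on `Λ₁`** (`ker(1 − t̄) = im(1 − t̄)` on `V₁ = Λ₁/3Λ₁`, so `V₁ ≅ (𝔽₃[ε]/ε²)^d`-shaped,
post35): for `x ∈ Λ₁`, `(1 − t)x ∈ 3Λ₁` iff `x ∈ (1 − t)Λ₁` (same argument as on `Λ_P`: apply `1 − t`, use
`(1 − t)² = −3t` and cancel `3`). [cite: Harrison2011X0108, §2] -/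
theorem exists_sub_shiftInt_eq_three_smul_iff_of_mem_shiftSubOneLattice {x : periodHomologyHecke N}
    (hx : x ∈ shiftSubOneLattice N h9) :
    (∃ y ∈ shiftSubOneLattice N h9, (1 - shiftInt N h9) x = 3 • y) ↔
      ∃ z ∈ shiftSubOneLattice N h9, x = (1 - shiftInt N h9) z := by
  haveI := isAddTorsionFree_periodHomologyHecke N
  have hxP := shiftSubOneLattice_le_prymLattice N h9 hx
  constructor
  · rintro ⟨y, hy, hxy⟩
    have h1 : (1 - shiftInt N h9) ((1 - shiftInt N h9) x) = 3 • (1 - shiftInt N h9) y := by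
      rw [hxy, map_nsmul]
    rw [one_sub_shiftInt_sq_apply_of_mem_prymLattice N h9 hxP, ← neg_nsmul] at h1
    have h2 : -shiftInt N h9 x = (1 - shiftInt N h9) y :=
      nsmul_right_injective (by norm_num : (3 : ℕ) ≠ 0) h1
    refine ⟨-(shiftInt N h9 (shiftInt N h9 y)),
      neg_mem (shiftInt_mem_shiftSubOneLattice N h9 (shiftInt_mem_shiftSubOneLattice N h9 hy)), ?_⟩
    have h3 : x = shiftInt N h9 (shiftInt N h9 (shiftInt N h9 x)) := (shiftInt_shiftInt_shiftInt N h9 x).symm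
    rw [h3, ← neg_neg (shiftInt N h9 x), map_neg, map_neg, h2]
    simp only [LinearMap.sub_apply, Module.End.one_apply, map_sub, map_neg, shiftInt_shiftInt_shiftInt]
  · rintro ⟨z, hz, rfl⟩
    refine ⟨-(shiftInt N h9 z), neg_mem (shiftInt_mem_shiftSubOneLattice N h9 hz), ?_⟩
    rw [one_sub_shiftInt_sq_apply_of_mem_prymLattice N h9 (shiftSubOneLattice_le_prymLattice N h9 hz), smul_neg]

variable {N} in
/-- **`T_p` restricted to `Λ₁`** (`p ≠ 3` prime), as a `ℤ`-linear endomorphism of `Λ₁`.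
[cite: DiamondShurman2005, Prop. 5.2.2(a) (derived reading, see `T_smul_mem_shiftSubOneLattice`)] -/
def heckeOne {p : ℕ} (hp : p.Prime) (hp3 : p ≠ 3) : Module.End ℤ (shiftSubOneLattice N h9) where
  toFun x := ⟨HeckeRing0.T N 2 p hp • (x : periodHomologyHecke N), T_smul_mem_shiftSubOneLattice h9 hp hp3 x.2⟩
  map_add' x y := Subtype.ext (by simp only [Submodule.coe_add, smul_add])
  map_smul' n x := Subtype.ext (by
    simp only [Submodule.coe_smul_of_tower, eq_intCast, Int.cast_id]
    exact smul_comm _ _ _)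

variable {N} in
/-- Unfolding `heckeOne`. [cite: DiamondShurman2005, Prop. 5.2.2(a)] -/
@[simp] theorem coe_heckeOne {p : ℕ} (hp : p.Prime) (hp3 : p ≠ 3) (x : shiftSubOneLattice N h9) :
    ((heckeOne h9 hp hp3 x : shiftSubOneLattice N h9) : periodHomologyHecke N) =
      HeckeRing0.T N 2 p hp • (x : periodHomologyHecke N) :=
  rfl

variable {N} in
/-- The restricted Hecke operators on `Λ₁` commute. [cite: DiamondShurman2005, Prop. 5.2.4] -/
theorem heckeOne_comm {p q : ℕ} (hp : p.Prime) (hp3 : p ≠ 3) (hq : q.Prime) (hq3 : q ≠ 3)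
    (x : shiftSubOneLattice N h9) :
    heckeOne h9 hp hp3 (heckeOne h9 hq hq3 x) = heckeOne h9 hq hq3 (heckeOne h9 hp hp3 x) := by
  apply Subtype.ext
  simp only [coe_heckeOne, smul_smul, mul_comm]

variable {N} in
/-- `t T_p = T_p t` on `Λ₁` for `p ≡ 1 (mod 3)`. [cite: DiamondShurman2005, Prop. 5.2.2(a) (derived reading, see `shiftInt_smul_T_of_mod_three_eq_one`)] -/
theorem shiftOne_heckeOne_of_mod_three_eq_one {p : ℕ} (hp : p.Prime) (hp3 : p ≠ 3) (hp1 : p % 3 = 1)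
    (x : shiftSubOneLattice N h9) :
    shiftOne N h9 (heckeOne h9 hp hp3 x) = heckeOne h9 hp hp3 (shiftOne N h9 x) :=
  Subtype.ext (shiftInt_smul_T_of_mod_three_eq_one N h9 hp hp1 _)

variable {N} in
/-- `t T_p = T_p t²` on `Λ₁` for `p ≡ 2 (mod 3)`. [cite: DiamondShurman2005, Prop. 5.2.2(a) (derived reading, see `shiftInt_smul_T_of_mod_three_eq_two`)] -/
theorem shiftOne_heckeOne_of_mod_three_eq_two {p : ℕ} (hp : p.Prime) (hp3 : p ≠ 3) (hp2 : p % 3 = 2)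
    (x : shiftSubOneLattice N h9) :
    shiftOne N h9 (heckeOne h9 hp hp3 x) = heckeOne h9 hp hp3 (shiftOne N h9 (shiftOne N h9 x)) :=
  Subtype.ext (shiftInt_smul_T_of_mod_three_eq_two N h9 hp hp2 _)

/-- **The period map on `Λ₁`**: `ev_f(t y − y) = ev_{f∣t − f}(y)`. [cite: Manin1972, Prop. 1.4] -/
theorem periodMap_shiftInt_sub (f : CuspForm (Gamma0 N) 2) (y : periodHomologyHecke N) :
    periodMap N f (shiftInt N h9 y - y) = periodMap N (shiftCuspForm N h9 f - f) y := by
  rw [map_sub, periodMap_shiftInt, periodMap_apply, periodMap_apply, periodMap_apply, map_sub]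

/-- **`ev_f` kills the fixed lattice `Λ_B` when `f + f∣t + f∣t² = 0`** (e.g. `f = f^*` a twist-pair member
with `a_{3n} = 0`; post35: "`ev_{f*}` kills `ker(t − 1)`"): for `t x = x`,
`3·x(f) = x(f + f∣t + f∣t²) = 0`. [cite: Manin1972, Prop. 1.4] -/
theorem periodMap_eq_zero_of_mem_fixedLattice {f : CuspForm (Gamma0 N) 2}
    (hf : f + shiftCuspForm N h9 f + shiftCuspForm N h9 (shiftCuspForm N h9 f) = 0)
    {x : periodHomologyHecke N} (hx : x ∈ fixedLattice N h9) : periodMap N f x = 0 := by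
  rw [mem_fixedLattice_iff] at hx
  have h1 : periodMap N (shiftCuspForm N h9 f) x = periodMap N f x := by
    rw [← periodMap_shiftInt, hx]
  have h2 : periodMap N (shiftCuspForm N h9 (shiftCuspForm N h9 f)) x = periodMap N f x := by
    rw [← periodMap_shiftInt, hx, ← periodMap_shiftInt, hx]
  have h3 : (3 : ℂ) * (x : Module.Dual ℂ (CuspForm (Gamma0 N) 2)) f = 0 := by
    have h := congrArg (fun g : CuspForm (Gamma0 N) 2 ↦ periodMap N g x) hf
    simp only [periodMap_apply, map_add, map_zero] at h h1 h2
    rw [h1, h2] at h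
    linear_combination h
  rw [periodMap_apply]
  exact (mul_eq_zero.mp h3).resolve_left (by norm_num)

variable (R : Type*) [CommRing R]

/-- **`V₁(R) := R ⊗ Λ₁`** — the mod-`R` fibre of `Λ₁` (`V₁ = Λ₁/3Λ₁` for `R = 𝔽₃`; NOT a subspace of
`H(N; 𝔽₃)`, as `Λ₁` has index `3^{r−2}` in the saturated `Λ_P`). An `abbrev` for the tensor product.
[cite: HatcherAT2002, §3.A Cor. 3A.4] -/
abbrev ShiftSubOneModule : Type _ :=
  R ⊗[ℤ] shiftSubOneLattice N h9

/-- `t` on `V₁(R)`. [cite: Harrison2011X0108, §2] -/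
def shiftOneR : Module.End R (ShiftSubOneModule N h9 R) :=
  (shiftOne N h9).baseChange R

/-- `t (r ⊗ x) = r ⊗ t x` on `V₁(R)`. [cite: Harrison2011X0108, §2] -/
@[simp] theorem shiftOneR_tmul (r : R) (x : shiftSubOneLattice N h9) :
    shiftOneR N h9 R (r ⊗ₜ[ℤ] x) = r ⊗ₜ[ℤ] shiftOne N h9 x :=
  rfl

/-- `t³ = 1` on `V₁(R)`. [cite: Harrison2011X0108, §2] -/
theorem shiftOneR_shiftOneR_shiftOneR (v : ShiftSubOneModule N h9 R) :
    shiftOneR N h9 R (shiftOneR N h9 R (shiftOneR N h9 R v)) = v := by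
  induction v using TensorProduct.induction_on with
  | zero => simp
  | tmul r x => simp only [shiftOneR_tmul, shiftOne_shiftOne_shiftOne]
  | add a b ha hb => simp only [map_add, ha, hb]

variable {N R} in
/-- `T_p` on `V₁(R)` (`p ≠ 3`). [cite: DiamondShurman2005, Prop. 5.2.2(a) (derived reading, see `heckeOne`)] -/
def heckeOneR {p : ℕ} (hp : p.Prime) (hp3 : p ≠ 3) : Module.End R (ShiftSubOneModule N h9 R) :=
  (heckeOne h9 hp hp3).baseChange R

variable {N R} in
/-- `T_p (r ⊗ x) = r ⊗ T_p x` on `V₁(R)`. [cite: DiamondShurman2005, Prop. 5.2.2(a)] -/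
@[simp] theorem heckeOneR_tmul {p : ℕ} (hp : p.Prime) (hp3 : p ≠ 3) (r : R) (x : shiftSubOneLattice N h9) :
    heckeOneR h9 hp hp3 (R := R) (r ⊗ₜ[ℤ] x) = r ⊗ₜ[ℤ] heckeOne h9 hp hp3 x :=
  rfl

variable {N R} in
/-- The `T_p` on `V₁(R)` commute. [cite: DiamondShurman2005, Prop. 5.2.4] -/
theorem heckeOneR_comm {p q : ℕ} (hp : p.Prime) (hp3 : p ≠ 3) (hq : q.Prime) (hq3 : q ≠ 3) :
    heckeOneR h9 hp hp3 (R := R) ∘ₗ heckeOneR h9 hq hq3 = heckeOneR h9 hq hq3 ∘ₗ heckeOneR h9 hp hp3 := by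
  refine TensorProduct.AlgebraTensorModule.ext fun r x ↦ ?_
  simp only [LinearMap.comp_apply, heckeOneR_tmul, heckeOne_comm h9 hp hp3 hq hq3]

variable {N R} in
/-- `t T_p = T_p t` on `V₁(R)` for `p ≡ 1 (mod 3)`. [cite: DiamondShurman2005, Prop. 5.2.2(a) (derived reading)] -/
theorem shiftOneR_comp_heckeOneR_of_mod_three_eq_one {p : ℕ} (hp : p.Prime) (hp3 : p ≠ 3) (hp1 : p % 3 = 1) :
    shiftOneR N h9 R ∘ₗ heckeOneR h9 hp hp3 = heckeOneR h9 hp hp3 ∘ₗ shiftOneR N h9 R := by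
  refine TensorProduct.AlgebraTensorModule.ext fun r x ↦ ?_
  simp only [LinearMap.comp_apply, heckeOneR_tmul, shiftOneR_tmul, shiftOne_heckeOne_of_mod_three_eq_one h9 hp hp3 hp1]

variable {N R} in
/-- `t T_p = T_p t²` on `V₁(R)` for `p ≡ 2 (mod 3)`. [cite: DiamondShurman2005, Prop. 5.2.2(a) (derived reading)] -/
theorem shiftOneR_comp_heckeOneR_of_mod_three_eq_two {p : ℕ} (hp : p.Prime) (hp3 : p ≠ 3) (hp2 : p % 3 = 2) :
    shiftOneR N h9 R ∘ₗ heckeOneR h9 hp hp3 = heckeOneR h9 hp hp3 ∘ₗ shiftOneR N h9 R ∘ₗ shiftOneR N h9 R := by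
  refine TensorProduct.AlgebraTensorModule.ext fun r x ↦ ?_
  simp only [LinearMap.comp_apply, heckeOneR_tmul, shiftOneR_tmul, shiftOne_heckeOne_of_mod_three_eq_two h9 hp hp3 hp2]

/-- **Isotypic pieces of `V₁(R)`**: `V₁[a] := ⋂_{p ∈ S, p ≠ 3} ker(T_p − a_p)`. [cite: DiamondShurman2005, §6.3] -/
def isotypicOne (S : Set ℕ) (a : ℕ → R) : Submodule R (ShiftSubOneModule N h9 R) :=
  ⨅ (p : ℕ), ⨅ (hp : p.Prime), ⨅ (hp3 : p ≠ 3), ⨅ (_ : p ∈ S),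
    LinearMap.ker (heckeOneR h9 hp hp3 (R := R) - a p • (1 : Module.End R (ShiftSubOneModule N h9 R)))

/-- `v ∈ V₁[a] ↔ T_p v = a_p v` for all primes `p ∈ S`, `p ≠ 3`. [cite: DiamondShurman2005, §6.3] -/
theorem mem_isotypicOne_iff {S : Set ℕ} {a : ℕ → R} (v : ShiftSubOneModule N h9 R) :
    v ∈ isotypicOne N h9 R S a ↔
      ∀ (p : ℕ) (hp : p.Prime) (hp3 : p ≠ 3), p ∈ S → heckeOneR h9 hp hp3 v = a p • v := by
  simp only [isotypicOne, Submodule.mem_iInf, LinearMap.mem_ker, LinearMap.sub_apply, LinearMap.smul_apply,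
    Module.End.one_apply, sub_eq_zero]

/-- **Generalised isotypic pieces of `V₁(R)`** (the `𝔪`-primary part when `𝔪 ↔ a`):
`V₁[a^∞] := ⋂_{p ∈ S, p ≠ 3} ⋃_k ker(T_p − a_p)^k` (Mathlib `Module.End.maxGenEigenspace`). For a field `R`
and `V₁(R)` finite-dimensional these are the simultaneous generalised eigenspaces of the commuting family
`(T_p)`, whose direct sum over all systems `a` is `V₁(R)` once the eigenvalues lie in `R`
(Mathlib `Module.End.iSup_iInf_maxGenEigenspace_eq_top_of_forall_mapsTo`); the isotypic PROJECTION asked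
for in post35 is the projection of that decomposition. [cite: DiamondShurman2005, §6.3] -/
def genIsotypicOne (S : Set ℕ) (a : ℕ → R) : Submodule R (ShiftSubOneModule N h9 R) :=
  ⨅ (p : ℕ), ⨅ (hp : p.Prime), ⨅ (hp3 : p ≠ 3), ⨅ (_ : p ∈ S), (heckeOneR h9 hp hp3 (R := R)).maxGenEigenspace (a p)

/-- `V₁[a] ≤ V₁[a^∞]`. [cite: DiamondShurman2005, §6.3] -/
theorem isotypicOne_le_genIsotypicOne (S : Set ℕ) (a : ℕ → R) :
    isotypicOne N h9 R S a ≤ genIsotypicOne N h9 R S a := by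
  intro v hv
  rw [mem_isotypicOne_iff] at hv
  simp only [genIsotypicOne, Submodule.mem_iInf]
  intro p hp hp3 hpS
  rw [Module.End.mem_maxGenEigenspace]
  exact ⟨1, by rw [pow_one, LinearMap.sub_apply, LinearMap.smul_apply, Module.End.one_apply, hv p hp hp3 hpS,
    sub_self]⟩

end ShiftSubOne

end Literature.NumberTheory.ModularSymbols

end
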